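import Summits.CriticalPhenomena.PercolationContinuityZ3.Theorems.PercNearOneGluingAdditiveGluingBystanderCluster
import HarnessLib

/-!
# A van den Berg–Häggström–Kahn inequality with a bystander cluster

Crux `PercNearOneGluing.AdditiveGluing` (stmt-CriticalPhenomena-4576), line
`subuniform-dead-pocket-maximum`, kernel `C1` (|A∖b| = 2) of `stub_goodStep` (siege k42); file 2 (the
inequality itself; tools in `PercNearOneGluingAdditiveGluingBystanderCluster.lean`).

## The inequality (`BystanderBHK.core`)

Bernoulli bond percolation with arbitrary edge probabilities on a finite vertex set, restricted to a vertex
set `U` (product weight `BHK2006.weight w` on `Set (Sym2 V)`).  Fix a source `s ∈ U`, a *bystander* `o`, an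
arbitrary family `𝓡` of vertex sets none of which contains `s`, and for `T ⊆ V` put `R_T = {s ↮ T}`
(`BHK2006.rD`), `C_s` the open edge cluster of `s` (`BHK2006.rC`), `K` the open vertex cluster of `o` and
`E_T = {K ∩ T ≠ ∅} ∪ {K ∈ 𝓡}` (the **bystander event**; NOT an increasing event).  Then for `F ≥ 0`
increasing in `C_s` and all `X, Y ⊆ U`,
`E[F(C_s) 1_{E_X} 1_{R_X}] · P(R_Y) ≤ E[F(C_s) 1_{R_{X∩Y}}] · E[1_{E_{X∪Y}} 1_{R_{X∪Y}}]`.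
With `o ∈ X = Y` (so `E ≡ 1`) this is BHK 2006 Thm 1.1/1.2 (`B = 1`); with `X = Y = {a₂}`, `s = a₁`,
`F = 1{a₁ ↔ b}`: given `a₁ ↮ a₂`, `{a₁ ↔ b}` is negatively correlated with `{o ↔ a₂} ∪ {C(o) ∈ 𝓡}` for
EVERY family `𝓡` of "dead pockets" — the engine behind Kozma–Nitzan's Lemma 3 for bystander events and the
two-relay kernel of goodness (next files of this series).

## Proof

BHK's induction on the vertex set (RSA 29 (2006), proof of Thm 1.1; tree: `BHK2006.core`) with the bystander
event riding along:
* `base` (valid for ALL `X, Y`): condition on the bystander's cluster `K = W` (Markov property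
  `sum_ind_rK_mul`); given `K = W ∌ s` the model off `W` is percolation on `U ∖ W`, `1_{E_X}` becomes the
  constant `[W ∩ X ≠ ∅ ∨ W ∈ 𝓡] ≤ [W ∩ (X ∪ Y) ≠ ∅ ∨ W ∈ 𝓡]`, and what is left,
  `E'[F 1_{R_{X∖W}}] · P(R_Y) ≤ E[F] · E'[1_{R_{(X∪Y)∖W}}]`, is Harris twice plus monotonicity under deletion of `W`;
* `core`, case `Z = X ∩ Y ≠ ∅`, `o ∉ Z`: condition on the set `S` of vertices joined to `Z` by an open edge;
  for `W ⊇ Z`, `R_W ↦ R'_{(W∖Z)∪S}`, `C_s ↦ C'_s` (BHK's (6)) and `E_W ↦ E'_{(W∖Z)∪S}` with the same `𝓡`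
  (`step_sum'`); conclude by the four functions theorem and the induction hypothesis on `U ∖ Z` — the E-factor
  travels with the `R_{X∪Y}` term, whose index `((X∪Y)∖Z) ∪ S₁ ∪ S₂` is reproduced EXACTLY; case `o ∈ Z`:
  `E ≡ 1`, BHK's own `core`.
-/

noncomputable section

namespace Summit.CriticalPhenomena.PercolationContinuityZ3.Theorems

open Literature.Probability.Percolation Literature.Probability.Percolation.BHK2006
open DecisionTree (ind ind_of_mem ind_of_not_mem ind_nonneg)
open scoped Classical

namespace BystanderBHK

variable {V : Type*}

variable [Fintype V]

/-- **The base inequality** (BHK's display (4) with a bystander): for all `X, Y`,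
`E[F 1_{E_X} 1_{R_X}] · P(R_Y) ≤ E[F] · E[1_{E_{X∪Y}} 1_{R_{X∪Y}}]`.
Proof: condition on the bystander's cluster `K = W` and apply Harris twice off `W`. [folklore] -/
theorem base (w : Sym2 V → ℝ) (hw0 : ∀ e, 0 ≤ w e) (hw1 : ∀ e, w e ≤ 1)
    (hm : ∑ ω, weight w ω = 1) (U : Finset V) (s o : V) (𝓡 : Set (Set V))
    (h𝓡 : ∀ W ∈ 𝓡, s ∉ W) (X Y : Set V)
    (F : Set (Sym2 V) → ℝ) (hF : Monotone F) (hF0 : ∀ a, 0 ≤ F a) :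
    (∑ ω, weight w ω * (F (rC U s ω) * (ind ({η | (∃ t ∈ X, t ∈ openCluster (η ∩ edgesIn U) o) ∨ openCluster (η ∩ edgesIn U) o ∈ 𝓡}) ω * ind (rD U s X) ω))) *
      (∑ ω, weight w ω * ind (rD U s Y) ω) ≤
    (∑ ω, weight w ω * F (rC U s ω)) *
      (∑ ω, weight w ω * (ind ({η | (∃ t ∈ X ∪ Y, t ∈ openCluster (η ∩ edgesIn U) o) ∨ openCluster (η ∩ edgesIn U) o ∈ 𝓡}) ω * ind (rD U s (X ∪ Y)) ω)) := by
  set RY := ∑ ω, weight w ω * ind (rD U s Y) ω with hRY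
  set EF := ∑ ω, weight w ω * F (rC U s ω) with hEF
  have hRYn : 0 ≤ RY :=
    Finset.sum_nonneg fun ω _ => mul_nonneg (weight_nonneg hw0 hw1 ω) (ind_nonneg _ _)
  have hEFn : 0 ≤ EF :=
    Finset.sum_nonneg fun ω _ => mul_nonneg (weight_nonneg hw0 hw1 ω) (hF0 _)
  rw [sum_fiber_rK U o (fun ω => weight w ω *
      (F (rC U s ω) * (ind ({η | (∃ t ∈ X, t ∈ openCluster (η ∩ edgesIn U) o) ∨ openCluster (η ∩ edgesIn U) o ∈ 𝓡}) ω * ind (rD U s X) ω))),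
    sum_fiber_rK U o (fun ω => weight w ω *
      (ind ({η | (∃ t ∈ X ∪ Y, t ∈ openCluster (η ∩ edgesIn U) o) ∨ openCluster (η ∩ edgesIn U) o ∈ 𝓡}) ω * ind (rD U s (X ∪ Y)) ω)),
    Finset.sum_mul, Finset.mul_sum]
  refine Finset.sum_le_sum fun W _ => ?_
  have hR4n : 0 ≤ ∑ ω, ind {ω | (openCluster (ω ∩ edgesIn U) o) = ↑W} ω * (weight w ω *
      (ind ({η | (∃ t ∈ X ∪ Y, t ∈ openCluster (η ∩ edgesIn U) o) ∨ openCluster (η ∩ edgesIn U) o ∈ 𝓡}) ω * ind (rD U s (X ∪ Y)) ω)) :=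
    Finset.sum_nonneg fun ω _ => mul_nonneg (ind_nonneg _ _)
      (mul_nonneg (weight_nonneg hw0 hw1 ω) (mul_nonneg (ind_nonneg _ _) (ind_nonneg _ _)))
  by_cases hsW : s ∈ W
  · -- `s ∈ W`: the fibre does not meet `E_X ∩ R_X`
    have h0 : ∑ ω, ind {ω | (openCluster (ω ∩ edgesIn U) o) = ↑W} ω * (weight w ω *
        (F (rC U s ω) * (ind ({η | (∃ t ∈ X, t ∈ openCluster (η ∩ edgesIn U) o) ∨ openCluster (η ∩ edgesIn U) o ∈ 𝓡}) ω * ind (rD U s X) ω))) = 0 := by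
      refine Finset.sum_eq_zero fun ω _ => ?_
      by_cases hK : (openCluster (ω ∩ edgesIn U) o) = ↑W
      · by_cases hD : ω ∈ rD U s X
        · have hE : ω ∉ {η | (∃ t ∈ X, t ∈ openCluster (η ∩ edgesIn U) o) ∨ openCluster (η ∩ edgesIn U) o ∈ 𝓡} := by
            rintro (⟨t, htX, htK⟩ | hR)
            · have hs : s ∈ (openCluster (ω ∩ edgesIn U) o) := by rw [hK]; exact hsW
              exact hD t htX (hs.symm.trans htK)
            · have hs : s ∈ (openCluster (ω ∩ edgesIn U) o) := by rw [hK]; exact hsW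
              exact h𝓡 _ hR hs
          rw [ind_of_not_mem hE]; ring
        · rw [ind_of_not_mem hD]; ring
      · rw [ind_of_not_mem (show ω ∉ {ω | (openCluster (ω ∩ edgesIn U) o) = ↑W} from hK)]; ring
    rw [h0, zero_mul]
    exact mul_nonneg hEFn hR4n
  · -- `s ∉ W`: Markov property at `K = W`, then Harris off `W`
    set U' := U \ W with hU'
    set cX : ℝ := if (∃ t ∈ X, t ∈ (↑W : Set V)) ∨ (↑W : Set V) ∈ 𝓡 then 1 else 0 with hcX
    set cXY : ℝ := if (∃ t ∈ X ∪ Y, t ∈ (↑W : Set V)) ∨ (↑W : Set V) ∈ 𝓡 then 1 else 0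
      with hcXY
    set Ψ₁ : Set (Sym2 V) → ℝ := fun ω => F (rC U' s ω) * ind (rD U' s (X \ ↑W)) ω with hΨ₁
    set Ψ₄ : Set (Sym2 V) → ℝ := fun ω => ind (rD U' s ((X ∪ Y) \ ↑W)) ω with hΨ₄
    have hcX0 : 0 ≤ cX := by rw [hcX]; split_ifs <;> norm_num
    have hcXY0 : 0 ≤ cXY := by rw [hcXY]; split_ifs <;> norm_num
    have hcc : cX ≤ cXY := by
      rw [hcX, hcXY]
      by_cases h : (∃ t ∈ X, t ∈ (↑W : Set V)) ∨ (↑W : Set V) ∈ 𝓡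
      · have h' : (∃ t ∈ X ∪ Y, t ∈ (↑W : Set V)) ∨ (↑W : Set V) ∈ 𝓡 := by
          rcases h with ⟨t, ht, htW⟩ | hR
          · exact Or.inl ⟨t, Or.inl ht, htW⟩
          · exact Or.inr hR
        rw [if_pos h, if_pos h']
      · rw [if_neg h]; split_ifs <;> norm_num
    have hmK := massK_nonneg hw0 hw1 U o W
    -- the two fibre sums
    have e1 : ∑ ω, ind {ω | (openCluster (ω ∩ edgesIn U) o) = ↑W} ω * (weight w ω *
        (F (rC U s ω) * (ind ({η | (∃ t ∈ X, t ∈ openCluster (η ∩ edgesIn U) o) ∨ openCluster (η ∩ edgesIn U) o ∈ 𝓡}) ω * ind (rD U s X) ω))) =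
        cX * ((∑ η, weight w η * ind {η | openCluster (η ∩ edgesIn U) o = ↑W} η) * ∑ ω, weight w ω * Ψ₁ ω) := by
      have hΨ : ∀ ω, Ψ₁ (ω \ meeting W) = Ψ₁ ω := fun ω => by
        simp only [hΨ₁, hU', rC_diff_meeting]
        rw [ind_congr (mem_rD_diff_meeting U W s (X \ ↑W) ω)]
      rw [← sum_ind_rK_mul w hm U W o Ψ₁ hΨ, Finset.mul_sum]
      refine Finset.sum_congr rfl fun ω _ => ?_
      by_cases hK : (openCluster (ω ∩ edgesIn U) o) = ↑W
      · have hKm : ω ∈ {ω | (openCluster (ω ∩ edgesIn U) o) = ↑W} := hK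
        rw [rC_restrict_rK hK hsW, ind_congr (mem_rD_iff_rK hK hsW X)]
        have hE : ind ({η | (∃ t ∈ X, t ∈ openCluster (η ∩ edgesIn U) o) ∨ openCluster (η ∩ edgesIn U) o ∈ 𝓡}) ω = cX := by
          rw [hcX]
          by_cases h : (∃ t ∈ X, t ∈ (↑W : Set V)) ∨ (↑W : Set V) ∈ 𝓡
          · rw [if_pos h, ind_of_mem ((mem_rE_iff_rK hK 𝓡 X).2 h)]
          · rw [if_neg h, ind_of_not_mem (fun h' => h ((mem_rE_iff_rK hK 𝓡 X).1 h'))]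
        rw [hE]; simp only [hΨ₁, hU']; ring
      · rw [ind_of_not_mem (show ω ∉ {ω | (openCluster (ω ∩ edgesIn U) o) = ↑W} from hK)]; ring
    have e4 : ∑ ω, ind {ω | (openCluster (ω ∩ edgesIn U) o) = ↑W} ω * (weight w ω *
        (ind ({η | (∃ t ∈ X ∪ Y, t ∈ openCluster (η ∩ edgesIn U) o) ∨ openCluster (η ∩ edgesIn U) o ∈ 𝓡}) ω * ind (rD U s (X ∪ Y)) ω)) =
        cXY * ((∑ η, weight w η * ind {η | openCluster (η ∩ edgesIn U) o = ↑W} η) * ∑ ω, weight w ω * Ψ₄ ω) := by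
      have hΨ : ∀ ω, Ψ₄ (ω \ meeting W) = Ψ₄ ω := fun ω => by
        simp only [hΨ₄, hU']
        rw [ind_congr (mem_rD_diff_meeting U W s ((X ∪ Y) \ ↑W) ω)]
      rw [← sum_ind_rK_mul w hm U W o Ψ₄ hΨ, Finset.mul_sum]
      refine Finset.sum_congr rfl fun ω _ => ?_
      by_cases hK : (openCluster (ω ∩ edgesIn U) o) = ↑W
      · rw [ind_congr (mem_rD_iff_rK hK hsW (X ∪ Y))]
        have hE : ind ({η | (∃ t ∈ X ∪ Y, t ∈ openCluster (η ∩ edgesIn U) o) ∨ openCluster (η ∩ edgesIn U) o ∈ 𝓡}) ω = cXY := by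
          rw [hcXY]
          by_cases h : (∃ t ∈ X ∪ Y, t ∈ (↑W : Set V)) ∨ (↑W : Set V) ∈ 𝓡
          · rw [if_pos h, ind_of_mem ((mem_rE_iff_rK hK 𝓡 (X ∪ Y)).2 h)]
          · rw [if_neg h, ind_of_not_mem (fun h' => h ((mem_rE_iff_rK hK 𝓡 (X ∪ Y)).1 h'))]
        rw [hE]; simp only [hΨ₄, hU']; ring
      · rw [ind_of_not_mem (show ω ∉ {ω | (openCluster (ω ∩ edgesIn U) o) = ↑W} from hK)]; ring
    -- Harris off `W`
    set A := ∑ ω, weight w ω * Ψ₁ ω with hA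
    set B := ∑ ω, weight w ω * Ψ₄ ω with hB
    set EF' := ∑ ω, weight w ω * F (rC U' s ω) with hEF'
    set RX' := ∑ ω, weight w ω * ind (rD U' s (X \ ↑W)) ω with hRX'
    set RY' := ∑ ω, weight w ω * ind (rD U' s (Y \ ↑W)) ω with hRY'
    have hFm : Monotone fun ω => F (rC U' s ω) := fun a b hab => hF (rC_mono U' s hab)
    have hEF'n : 0 ≤ EF' :=
      Finset.sum_nonneg fun ω _ => mul_nonneg (weight_nonneg hw0 hw1 ω) (hF0 _)
    have hRX'n : 0 ≤ RX' :=
      Finset.sum_nonneg fun ω _ => mul_nonneg (weight_nonneg hw0 hw1 ω) (ind_nonneg _ _)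
    have hBn : 0 ≤ B :=
      Finset.sum_nonneg fun ω _ => mul_nonneg (weight_nonneg hw0 hw1 ω) (ind_nonneg _ _)
    have h1 : A ≤ EF' * RX' :=
      harris_mono_anti hw0 hw1 hm (fun _ => hF0 _) hFm (ind_rD_antitone U' s _)
        (fun _ => ind_le_one _ _)
    have h2 : EF' ≤ EF :=
      Finset.sum_le_sum fun ω _ => mul_le_mul_of_nonneg_left
        (hF (rC_mono_set Finset.sdiff_subset s ω)) (weight_nonneg hw0 hw1 ω)
    have h3 : RY ≤ RY' :=
      Finset.sum_le_sum fun ω _ => mul_le_mul_of_nonneg_left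
        (ind_mono (rD_subset_rD_sdiff U W s Y) ω) (weight_nonneg hw0 hw1 ω)
    have h4 : RX' * RY' ≤ B := by
      have h := harris_anti_anti hw0 hw1 hm (ind_rD_antitone U' s (X \ ↑W))
        (ind_rD_antitone U' s (Y \ ↑W)) (fun _ => ind_le_one _ _) (fun _ => ind_le_one _ _)
      refine h.trans (le_of_eq (Finset.sum_congr rfl fun ω _ => ?_))
      simp only [hΨ₄]
      rw [← ind_inter, ← rD_union, Set.union_sdiff_distrib]
    have key : A * RY ≤ EF * B :=
      calc A * RY ≤ (EF' * RX') * RY := mul_le_mul_of_nonneg_right h1 hRYn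
        _ ≤ (EF * RX') * RY' :=
          mul_le_mul (mul_le_mul_of_nonneg_right h2 hRX'n) h3 hRYn (mul_nonneg hEFn hRX'n)
        _ = EF * (RX' * RY') := by ring
        _ ≤ EF * B := mul_le_mul_of_nonneg_left h4 hEFn
    rw [e1, e4]
    calc cX * ((∑ η, weight w η * ind {η | openCluster (η ∩ edgesIn U) o = ↑W} η) * A) * RY = (cX * (∑ η, weight w η * ind {η | openCluster (η ∩ edgesIn U) o = ↑W} η)) * (A * RY) := by ring
      _ ≤ (cX * (∑ η, weight w η * ind {η | openCluster (η ∩ edgesIn U) o = ↑W} η)) * (EF * B) :=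
        mul_le_mul_of_nonneg_left key (mul_nonneg hcX0 hmK)
      _ ≤ (cXY * (∑ η, weight w η * ind {η | openCluster (η ∩ edgesIn U) o = ↑W} η)) * (EF * B) :=
        mul_le_mul_of_nonneg_right (mul_le_mul_of_nonneg_right hcc hmK) (mul_nonneg hEFn hBn)
      _ = EF * (cXY * ((∑ η, weight w η * ind {η | openCluster (η ∩ edgesIn U) o = ↑W} η) * B)) := by ring


/-! ### The main inequality, by induction on the vertex set -/

/-- **BHK Theorem 1.1 with a bystander** (functional form, percolation restricted to `U`):
for `s ∈ U`, `X, Y ⊆ U`, `F ≥ 0` increasing in `C_s`, and any family `𝓡` of vertex sets not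
containing `s`,
`E[F(C) 1_{E_X} 1{s↮X}] · P(s ↮ Y) ≤ E[F(C) 1{s ↮ X∩Y}] · E[1_{E_{X∪Y}} 1{s ↮ X∪Y}]`,
where `E_T = {o ↔ T} ∪ {C(o) ∈ 𝓡}` is the (non-monotone) bystander event.
Strong induction on `U` following BHK pp. 3–5, the bystander event riding along. [folklore] -/
theorem core (w : Sym2 V → ℝ) (hw0 : ∀ e, 0 ≤ w e) (hw1 : ∀ e, w e ≤ 1)
    (hm : ∑ ω, weight w ω = 1) (o : V) (𝓡 : Set (Set V)) (U : Finset V) :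
    ∀ (s : V), s ∈ U → (∀ W ∈ 𝓡, s ∉ W) → ∀ (X Y : Set V), X ⊆ ↑U → Y ⊆ ↑U →
    ∀ (F : Set (Sym2 V) → ℝ), Monotone F → (∀ a, 0 ≤ F a) →
    (∑ ω, weight w ω * (F (rC U s ω) * (ind ({η | (∃ t ∈ X, t ∈ openCluster (η ∩ edgesIn U) o) ∨ openCluster (η ∩ edgesIn U) o ∈ 𝓡}) ω * ind (rD U s X) ω))) *
      (∑ ω, weight w ω * ind (rD U s Y) ω) ≤
    (∑ ω, weight w ω * (F (rC U s ω) * ind (rD U s (X ∩ Y)) ω)) *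
      (∑ ω, weight w ω * (ind ({η | (∃ t ∈ X ∪ Y, t ∈ openCluster (η ∩ edgesIn U) o) ∨ openCluster (η ∩ edgesIn U) o ∈ 𝓡}) ω * ind (rD U s (X ∪ Y)) ω)) := by
  induction U using Finset.strongInduction with
  | H U ih =>
  intro s hsU h𝓡 X Y hXU hYU F hF hF0
  -- nonnegativity of the right-hand side
  have hRHS : 0 ≤ (∑ ω, weight w ω * (F (rC U s ω) * ind (rD U s (X ∩ Y)) ω)) *
      (∑ ω, weight w ω * (ind ({η | (∃ t ∈ X ∪ Y, t ∈ openCluster (η ∩ edgesIn U) o) ∨ openCluster (η ∩ edgesIn U) o ∈ 𝓡}) ω * ind (rD U s (X ∪ Y)) ω)) :=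
    mul_nonneg (Finset.sum_nonneg fun ω _ => mul_nonneg (weight_nonneg hw0 hw1 ω)
      (mul_nonneg (hF0 _) (ind_nonneg _ _)))
      (Finset.sum_nonneg fun ω _ => mul_nonneg (weight_nonneg hw0 hw1 ω)
        (mul_nonneg (ind_nonneg _ _) (ind_nonneg _ _)))
  -- trivial cases `s ∈ X`, `s ∈ Y`
  by_cases hsX : s ∈ X
  · have h0 : ∑ ω, weight w ω * (F (rC U s ω) * (ind ({η | (∃ t ∈ X, t ∈ openCluster (η ∩ edgesIn U) o) ∨ openCluster (η ∩ edgesIn U) o ∈ 𝓡}) ω * ind (rD U s X) ω)) = 0 :=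
      Finset.sum_eq_zero fun ω _ => by
        rw [rD_eq_empty hsX, ind_of_not_mem (Set.notMem_empty ω)]; ring
    rw [h0, zero_mul]; exact hRHS
  by_cases hsY : s ∈ Y
  · have h0 : ∑ ω, weight w ω * ind (rD U s Y) ω = 0 :=
      Finset.sum_eq_zero fun ω _ => by
        rw [rD_eq_empty hsY, ind_of_not_mem (Set.notMem_empty ω)]; ring
    rw [h0, mul_zero]; exact hRHS
  -- `Z := X ∩ Y`
  set Z : Finset V := U.filter fun v => v ∈ X ∧ v ∈ Y with hZ
  have hZU : Z ⊆ U := Finset.filter_subset _ _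
  have hmemZ : ∀ v, v ∈ Z ↔ v ∈ X ∧ v ∈ Y := fun v => by
    simp only [hZ, Finset.mem_filter, and_iff_right_iff_imp]
    exact fun h => hXU h.1
  have hsZ : s ∉ Z := fun h => hsX ((hmemZ s).1 h).1
  rcases Z.eq_empty_or_nonempty with hZe | hZne
  · /- `X ∩ Y = ∅`: the base inequality. -/
    have hXY : ∀ ω, ind (rD U s (X ∩ Y)) ω = 1 := fun ω =>
      ind_of_mem fun x hx _ => by
        have : x ∈ Z := (hmemZ x).2 hx
        rw [hZe] at this
        exact absurd this (Finset.notMem_empty x)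
    simp_rw [hXY, mul_one]
    exact base w hw0 hw1 hm U s o 𝓡 h𝓡 X Y F hF hF0
  · have hZX : (↑Z : Set V) ⊆ X := fun v hv => ((hmemZ v).1 hv).1
    have hZY : (↑Z : Set V) ⊆ Y := fun v hv => ((hmemZ v).1 hv).2
    have hZXY : (↑Z : Set V) ⊆ X ∩ Y := fun v hv => (hmemZ v).1 hv
    have hZXuY : (↑Z : Set V) ⊆ X ∪ Y := fun v hv => Or.inl (((hmemZ v).1 hv).1)
    by_cases hoZ : o ∈ Z
    · /- `o ∈ X ∩ Y`: the bystander events are sure; this is BHK Thm 1.1 with `B = 1`. -/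
      have hoX : o ∈ X := hZX hoZ
      have hEX : ∀ ω, ind ({η | (∃ t ∈ X, t ∈ openCluster (η ∩ edgesIn U) o) ∨ openCluster (η ∩ edgesIn U) o ∈ 𝓡}) ω = 1 := fun ω => ind_of_mem (mem_rE_of_mem 𝓡 hoX ω)
      have hEXY : ∀ ω, ind ({η | (∃ t ∈ X ∪ Y, t ∈ openCluster (η ∩ edgesIn U) o) ∨ openCluster (η ∩ edgesIn U) o ∈ 𝓡}) ω = 1 := fun ω =>
        ind_of_mem (mem_rE_of_mem 𝓡 (Or.inl hoX) ω)
      simp_rw [hEX, hEXY, one_mul]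
      have key := BHK2006.core w hw0 hw1 hm U s hsU X Y hXU hYU F (fun _ => 1) hF
        monotone_const hF0 (fun _ => zero_le_one)
      simpa only [mul_one, one_mul] using key
    /- `Z ≠ ∅`, `o ∉ Z`: condition on `S` and apply the four functions theorem with the
    induction hypothesis on `U ∖ Z`. -/
    have hss : U \ Z ⊂ U := Finset.sdiff_ssubset hZU hZne
    have hsU' : s ∈ U \ Z := Finset.mem_sdiff.2 ⟨hsU, hsZ⟩
    -- the four sums, conditioned on `S`
    have e1 := step_sum' hZU hsZ hoZ hZX w hm 𝓡 F
    have e2 : ∑ ω, weight w ω * ind (rD U s Y) ω =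
        ∑ ω, weight w ω * blockE w (U \ Z) s (fun _ => 1) (Y \ ↑Z) (rS U Z ω) := by
      have := step_sum hZU hsZ hZY w hm (fun _ => 1)
      simpa only [one_mul] using this
    have e3 : ∑ ω, weight w ω * (F (rC U s ω) * ind (rD U s (X ∩ Y)) ω) =
        ∑ ω, weight w ω * blockE w (U \ Z) s F ((X ∩ Y) \ ↑Z) (rS U Z ω) :=
      step_sum hZU hsZ hZXY w hm F
    have e4 : ∑ ω, weight w ω * (ind ({η | (∃ t ∈ X ∪ Y, t ∈ openCluster (η ∩ edgesIn U) o) ∨ openCluster (η ∩ edgesIn U) o ∈ 𝓡}) ω * ind (rD U s (X ∪ Y)) ω) =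
        ∑ ω, weight w ω * (∑ η, weight w η * ((fun _ => 1) (rC (U \ Z) s η) * (ind {η' | (∃ t ∈ (X ∪ Y) \ ↑Z ∪ rS U Z ω, t ∈ openCluster (η' ∩ edgesIn (U \ Z)) o) ∨ openCluster (η' ∩ edgesIn (U \ Z)) o ∈ 𝓡} η * ind (rD (U \ Z) s ((X ∪ Y) \ ↑Z ∪ rS U Z ω)) η))) := by
      have := step_sum' hZU hsZ hoZ hZXuY w hm 𝓡 (fun _ => 1)
      simpa only [one_mul] using this
    rw [e1, e2, e3, e4]
    refine four_functions_theorem_univ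
      (fun ω => weight w ω * (∑ η, weight w η * (F (rC (U \ Z) s η) * (ind {η' | (∃ t ∈ X \ ↑Z ∪ rS U Z ω, t ∈ openCluster (η' ∩ edgesIn (U \ Z)) o) ∨ openCluster (η' ∩ edgesIn (U \ Z)) o ∈ 𝓡} η * ind (rD (U \ Z) s (X \ ↑Z ∪ rS U Z ω)) η))))
      (fun ω => weight w ω * blockE w (U \ Z) s (fun _ => 1) (Y \ ↑Z) (rS U Z ω))
      (fun ω => weight w ω * blockE w (U \ Z) s F ((X ∩ Y) \ ↑Z) (rS U Z ω))
      (fun ω => weight w ω * (∑ η, weight w η * ((fun _ => 1) (rC (U \ Z) s η) * (ind {η' | (∃ t ∈ (X ∪ Y) \ ↑Z ∪ rS U Z ω, t ∈ openCluster (η' ∩ edgesIn (U \ Z)) o) ∨ openCluster (η' ∩ edgesIn (U \ Z)) o ∈ 𝓡} η * ind (rD (U \ Z) s ((X ∪ Y) \ ↑Z ∪ rS U Z ω)) η))))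
      (fun ω => mul_nonneg (weight_nonneg hw0 hw1 ω) (blockE'_nonneg hw0 hw1 _ _ _ _ hF0 _ _))
      (fun ω => mul_nonneg (weight_nonneg hw0 hw1 ω)
        (blockE_nonneg hw0 hw1 _ _ (fun _ => zero_le_one) _ _))
      (fun ω => mul_nonneg (weight_nonneg hw0 hw1 ω) (blockE_nonneg hw0 hw1 _ _ hF0 _ _))
      (fun ω => mul_nonneg (weight_nonneg hw0 hw1 ω)
        (blockE'_nonneg hw0 hw1 _ _ _ _ (fun _ => zero_le_one) _ _))
      fun a b => ?_
    -- the Ahlswede–Daykin hypothesis: weight lattice identity × induction hypothesis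
    set Sa := rS U Z a with hSa
    set Sb := rS U Z b with hSb
    have hSaU : Sa ⊆ ↑(U \ Z) := rS_subset U Z a
    have hSbU : Sb ⊆ ↑(U \ Z) := rS_subset U Z b
    have hX1 : X \ ↑Z ∪ Sa ⊆ ↑(U \ Z) := Set.union_subset
      (fun v hv => by rw [Finset.coe_sdiff]; exact ⟨hXU hv.1, hv.2⟩) hSaU
    have hY1 : Y \ ↑Z ∪ Sb ⊆ ↑(U \ Z) := Set.union_subset
      (fun v hv => by rw [Finset.coe_sdiff]; exact ⟨hYU hv.1, hv.2⟩) hSbU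
    have IH := ih (U \ Z) hss s hsU' h𝓡 (X \ ↑Z ∪ Sa) (Y \ ↑Z ∪ Sb) hX1 hY1 F hF hF0
    -- monotonicity / equality in the conditioning sets
    have hsub3 : (X ∩ Y) \ ↑Z ∪ rS U Z (a ∩ b) ⊆ (X \ ↑Z ∪ Sa) ∩ (Y \ ↑Z ∪ Sb) := by
      refine Set.union_subset (fun v hv => ⟨Or.inl ⟨hv.1.1, hv.2⟩, Or.inl ⟨hv.1.2, hv.2⟩⟩) ?_
      exact fun v hv =>
        ⟨Or.inr (rS_inter_subset U Z a b hv).1, Or.inr (rS_inter_subset U Z a b hv).2⟩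
    have heq4 : (X \ ↑Z ∪ Sa) ∪ (Y \ ↑Z ∪ Sb) = (X ∪ Y) \ ↑Z ∪ rS U Z (a ∪ b) := by
      rw [rS_union]
      ext v
      simp only [Set.mem_union, Set.mem_sdiff, hSa, hSb]
      tauto
    have h3 : ∑ ω, weight w ω * (F (rC (U \ Z) s ω) *
        ind (rD (U \ Z) s ((X \ ↑Z ∪ Sa) ∩ (Y \ ↑Z ∪ Sb))) ω) ≤
        blockE w (U \ Z) s F ((X ∩ Y) \ ↑Z) (rS U Z (a ∩ b)) :=
      sum_ind_mono hw0 hw1 (fun _ => hF0 _) (rD_antitone hsub3)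
    have h4 : ∑ ω, weight w ω * (ind ({η | (∃ t ∈ (X \ ↑Z ∪ Sa) ∪ (Y \ ↑Z ∪ Sb), t ∈ openCluster (η ∩ edgesIn (U \ Z)) o) ∨ openCluster (η ∩ edgesIn (U \ Z)) o ∈ 𝓡}) ω *
        ind (rD (U \ Z) s ((X \ ↑Z ∪ Sa) ∪ (Y \ ↑Z ∪ Sb))) ω) =
        (∑ η, weight w η * ((fun _ => 1) (rC (U \ Z) s η) * (ind {η' | (∃ t ∈ (X ∪ Y) \ ↑Z ∪ rS U Z (a ∪ b), t ∈ openCluster (η' ∩ edgesIn (U \ Z)) o) ∨ openCluster (η' ∩ edgesIn (U \ Z)) o ∈ 𝓡} η * ind (rD (U \ Z) s ((X ∪ Y) \ ↑Z ∪ rS U Z (a ∪ b))) η))) := by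
      rw [heq4]; simp only [one_mul]
    have h2' : blockE w (U \ Z) s (fun _ => 1) (Y \ ↑Z) Sb =
        ∑ ω, weight w ω * ind (rD (U \ Z) s (Y \ ↑Z ∪ Sb)) ω := by
      simp only [blockE, one_mul]
    have hn3 : 0 ≤ ∑ ω, weight w ω * (F (rC (U \ Z) s ω) *
        ind (rD (U \ Z) s ((X \ ↑Z ∪ Sa) ∩ (Y \ ↑Z ∪ Sb))) ω) :=
      Finset.sum_nonneg fun ω _ => mul_nonneg (weight_nonneg hw0 hw1 ω)
        (mul_nonneg (hF0 _) (ind_nonneg _ _))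
    have hIH' : (∑ η, weight w η * (F (rC (U \ Z) s η) * (ind {η' | (∃ t ∈ X \ ↑Z ∪ Sa, t ∈ openCluster (η' ∩ edgesIn (U \ Z)) o) ∨ openCluster (η' ∩ edgesIn (U \ Z)) o ∈ 𝓡} η * ind (rD (U \ Z) s (X \ ↑Z ∪ Sa)) η))) *
        blockE w (U \ Z) s (fun _ => 1) (Y \ ↑Z) Sb ≤
        blockE w (U \ Z) s F ((X ∩ Y) \ ↑Z) (rS U Z (a ∩ b)) *
          (∑ η, weight w η * ((fun _ => 1) (rC (U \ Z) s η) * (ind {η' | (∃ t ∈ (X ∪ Y) \ ↑Z ∪ rS U Z (a ∪ b), t ∈ openCluster (η' ∩ edgesIn (U \ Z)) o) ∨ openCluster (η' ∩ edgesIn (U \ Z)) o ∈ 𝓡} η * ind (rD (U \ Z) s ((X ∪ Y) \ ↑Z ∪ rS U Z (a ∪ b))) η))) := by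
      rw [h2', ← h4]
      exact IH.trans (mul_le_mul_of_nonneg_right h3 (Finset.sum_nonneg fun ω _ =>
        mul_nonneg (weight_nonneg hw0 hw1 ω) (mul_nonneg (ind_nonneg _ _) (ind_nonneg _ _))))
    have hwab := weight_inter_mul_union w a b
    show weight w a * (∑ η, weight w η * (F (rC (U \ Z) s η) * (ind {η' | (∃ t ∈ X \ ↑Z ∪ Sa, t ∈ openCluster (η' ∩ edgesIn (U \ Z)) o) ∨ openCluster (η' ∩ edgesIn (U \ Z)) o ∈ 𝓡} η * ind (rD (U \ Z) s (X \ ↑Z ∪ Sa)) η))) *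
        (weight w b * blockE w (U \ Z) s (fun _ => 1) (Y \ ↑Z) Sb) ≤
      weight w (a ∩ b) * blockE w (U \ Z) s F ((X ∩ Y) \ ↑Z) (rS U Z (a ∩ b)) *
        (weight w (a ∪ b) *
          (∑ η, weight w η * ((fun _ => 1) (rC (U \ Z) s η) * (ind {η' | (∃ t ∈ (X ∪ Y) \ ↑Z ∪ rS U Z (a ∪ b), t ∈ openCluster (η' ∩ edgesIn (U \ Z)) o) ∨ openCluster (η' ∩ edgesIn (U \ Z)) o ∈ 𝓡} η * ind (rD (U \ Z) s ((X ∪ Y) \ ↑Z ∪ rS U Z (a ∪ b))) η))))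
    calc weight w a * (∑ η, weight w η * (F (rC (U \ Z) s η) * (ind {η' | (∃ t ∈ X \ ↑Z ∪ Sa, t ∈ openCluster (η' ∩ edgesIn (U \ Z)) o) ∨ openCluster (η' ∩ edgesIn (U \ Z)) o ∈ 𝓡} η * ind (rD (U \ Z) s (X \ ↑Z ∪ Sa)) η))) *
          (weight w b * blockE w (U \ Z) s (fun _ => 1) (Y \ ↑Z) Sb)
        = (weight w a * weight w b) *
          ((∑ η, weight w η * (F (rC (U \ Z) s η) * (ind {η' | (∃ t ∈ X \ ↑Z ∪ Sa, t ∈ openCluster (η' ∩ edgesIn (U \ Z)) o) ∨ openCluster (η' ∩ edgesIn (U \ Z)) o ∈ 𝓡} η * ind (rD (U \ Z) s (X \ ↑Z ∪ Sa)) η))) *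
            blockE w (U \ Z) s (fun _ => 1) (Y \ ↑Z) Sb) := by ring
      _ ≤ (weight w (a ∩ b) * weight w (a ∪ b)) *
          (blockE w (U \ Z) s F ((X ∩ Y) \ ↑Z) (rS U Z (a ∩ b)) *
            (∑ η, weight w η * ((fun _ => 1) (rC (U \ Z) s η) * (ind {η' | (∃ t ∈ (X ∪ Y) \ ↑Z ∪ rS U Z (a ∪ b), t ∈ openCluster (η' ∩ edgesIn (U \ Z)) o) ∨ openCluster (η' ∩ edgesIn (U \ Z)) o ∈ 𝓡} η * ind (rD (U \ Z) s ((X ∪ Y) \ ↑Z ∪ rS U Z (a ∪ b))) η)))) := by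
          rw [hwab]
          exact mul_le_mul_of_nonneg_left hIH'
            (mul_nonneg (weight_nonneg hw0 hw1 _) (weight_nonneg hw0 hw1 _))
      _ = _ := by ring


/-- **Registered sub-goal `stub_bystanderBHK_k42`** (siege k42): the bystander BHK inequality, closed form of
`BystanderBHK.core` (vertex type in `Type`). [folklore] -/
theorem stub_bystanderBHK_k42 : ∀ (V : Type) [Fintype V] (w : Sym2 V → ℝ), (∀ e, 0 ≤ w e) → (∀ e, w e ≤ 1) → (∑ ω, weight w ω = 1) → ∀ (o : V) (𝓡 : Set (Set V)) (U : Finset V) (s : V), s ∈ U → (∀ W ∈ 𝓡, s ∉ W) → ∀ (X Y : Set V), X ⊆ ↑U → Y ⊆ ↑U → ∀ (F : Set (Sym2 V) → ℝ), Monotone F → (∀ a, 0 ≤ F a) → (∑ ω, weight w ω * (F (rC U s ω) * (ind {η | (∃ t ∈ X, t ∈ openCluster (η ∩ edgesIn U) o) ∨ openCluster (η ∩ edgesIn U) o ∈ 𝓡} ω * ind (rD U s X) ω))) * (∑ ω, weight w ω * ind (rD U s Y) ω) ≤ (∑ ω, weight w ω * (F (rC U s ω) * ind (rD U s (X ∩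 Y)) ω)) * (∑ ω, weight w ω * (ind {η | (∃ t ∈ X ∪ Y, t ∈ openCluster (η ∩ edgesIn U) o) ∨ openCluster (η ∩ edgesIn U) o ∈ 𝓡} ω * ind (rD U s (X ∪ Y)) ω)) :=
  fun _ _ w hw0 hw1 hm o 𝓡 U s hsU h𝓡 X Y hXU hYU F hF hF0 =>
    core w hw0 hw1 hm o 𝓡 U s hsU h𝓡 X Y hXU hYU F hF hF0

end BystanderBHK

end Summit.CriticalPhenomena.PercolationContinuityZ3.Theorems
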